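import Literature.Analysis.FluidPDE.CarlemanCalculus
import HarnessLib

/-!
# Interior regularity inputs for the backward heat inequality `|∂ₜu + Δu| ≤ c₁(|u| + |∇u|)` (Seregin 2014, App. A.2–A.3)

Analysis/FluidPDE file in the backward-uniqueness track of the decomposition of **ns.S08**
`Literature.Analysis.FluidPDE.ess_endpoint`. The proofs of unique continuation through
spatial boundaries (ESS 2003, Thm. 4.1 = Seregin 2014, Thm. A.2.4 / Lemma A.1) and of backward
uniqueness in a half-space (ESS 2003, Thm. 5.1 = Seregin 2014, Thm. A.3.5 / Lemmas A.2–A.4)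
combine the two Carleman inequalities (proved: `Carleman.carleman_inequality_first`,
`Carleman.carleman_inequality_second`) with three **local regularity estimates** for functions
satisfying the backward heat inequality, which Seregin takes from the regularity theory of
linear parabolic equations [Ladyženskaja–Solonnikov–Ural′ceva 1968] without proof
("we may assume", Remark A.2, (A.2.18), (A.3.7), (A.3.15)). We vendor them here as named facts,
in the form printed, for vector-valued functions `v : ℝ × ℝⁿ → ℝᵐ` (time first, uncurried;
`∂ₜ = Carleman.dt`, `Δ = Carleman.lap`, `|∇v|² = Carleman.gradSq`), rendered for the `C²`
functions of the vendored `ess_unique_continuation` / `ess_backward_uniqueness` together with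
the printed `W^{2,1}_2` integrability hypotheses (each docstring records exactly which printed
hypotheses are kept and which are dropped, and why):

* `seregin_backwardHeat_sup_le_L2` — (A.2.18)/(A.3.15): the value at the bottom centre of the
  unit cylinder `B(x₀, 1) × ]1/2, 1[` is controlled by the `L²` norm over it,
  `|v(x₀, 1/2)|² ≤ c₉(c₁, n, m) ∫_{B(x₀,1)×]1/2,1[} |v|²` (backward equation: the cylinder lies
  in the future of the point);
* `seregin_backwardHeat_localMax_le_L2` — Remark A.2: on `Q(R, T) = B(R) × ]0, T[`,
  `sup_{Q(3R/4, 3T/4)} (|u| + √T |∇u|) ≤ c₃(c₁, R, T, n, m) ‖u‖_{L²(Q(R,T))}`;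
* `seregin_backwardHeat_halfspace_gradient_growth` — (A.3.7): on `Q₊ = ℝⁿ₊ × ]0, 1[`, the growth
  bound `|u| ≤ e^{A|x|²}` upgrades to `|u| + |∇u| ≤ c₃ e^{2A|x|²}` on `(ℝⁿ₊ + eₙ) × ]0, 1/2[`.

The constants are existentially quantified after the data they may depend on (we allow
dependence on `m` as well, which only weakens the claims).

## References

* G. Seregin, *Lecture notes on regularity theory for the Navier–Stokes equations*, World
  Scientific 2014, Appendix A: Remark A.2 (p. 208), (A.2.18) (p. 210), (A.3.7) (p. 212),
  (A.3.15) (p. 213).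
* O. A. Ladyženskaja, V. A. Solonnikov, N. N. Ural′ceva, *Linear and quasi-linear equations of
  parabolic type*, Transl. Math. Monogr. 23, AMS 1968, Chap. III §§7–12, Chap. IV §§9–10
  (local estimates; the source Seregin cites).
* L. Escauriaza, G. Seregin, V. Šverák, Russ. Math. Surveys 58:2 (2003), Remark 4.5, (4.18),
  (5.7) (the same inputs, citing [19] = LSU).
-/

noncomputable section

open MeasureTheory Set Function Filter Topology
open scoped InnerProductSpace RealInnerProductSpace

namespace Literature.Analysis.FluidPDE

namespace Carleman

/-- **Seregin 2014, (A.2.18) / (A.3.15)** (from the regularity theory for linear backward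
parabolic equations, LSU 1968): for every `c₁` there is `c₉ = c₉(c₁, n, m) > 0` such that for
every `x₀ ∈ ℝⁿ` and every `v : ℝ × ℝⁿ → ℝᵐ` of class `C²` on a neighbourhood of the closed
cylinder `[1/2, 1] × B̄(x₀, 1)` satisfying there the backward heat inequality
`|∂ₛv + Δv| ≤ c₁ (|∇v| + |v|)`, the value at the bottom centre is controlled by the `L²` norm
over the (future) unit cylinder:
`|v(x₀, 1/2)|² ≤ c₉ ∫_{]1/2,1[ × B(x₀,1)} |v|² dy ds`.
Seregin states this for `W^{2,1}_2` functions with the inequality a.e.; a `C²` function on a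
neighbourhood of the closed cylinder is `W^{2,1}_2` there, so this is a special case. Time first,
uncurried. [cite: Seregin2014, App. A.2 (A.2.18)]
[cite: LadyzhenskayaSolonnikovUraltseva1968, Chap. III §8 and Chap. IV §10 (local estimates; the source Seregin cites)] -/
def seregin_backwardHeat_sup_le_L2 : Prop :=
  ∀ (n m : ℕ) (c₁ : ℝ), ∃ c₉ : ℝ, 0 < c₉ ∧
    ∀ (x₀ : EuclideanSpace ℝ (Fin n))
      (v : ℝ × EuclideanSpace ℝ (Fin n) → EuclideanSpace ℝ (Fin m))
      (U : Set (ℝ × EuclideanSpace ℝ (Fin n))), IsOpen U →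
      Icc (1 / 2 : ℝ) 1 ×ˢ Metric.closedBall x₀ 1 ⊆ U →
      ContDiffOn ℝ 2 v U →
      (∀ z ∈ U, ‖dt v z + lap v z‖ ≤ c₁ * (Real.sqrt (gradSq v z) + ‖v z‖)) →
      ‖v ((1 / 2 : ℝ), x₀)‖ ^ 2 ≤
        c₉ * ∫ z in Ioo (1 / 2 : ℝ) 1 ×ˢ Metric.ball x₀ 1, ‖v z‖ ^ 2

/-- **Seregin 2014, Remark A.2** (from the regularity theory for parabolic equations, LSU 1968):
in the cylinder `Q(R, T) = B(R) × ]0, T[` let `u : ℝ × ℝⁿ → ℝᵐ` satisfy the hypotheses (A.2.1)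
`u ∈ W^{2,1}_2(Q(R,T))`, i.e. `|u| + |∇u| + |∇²u| + |∂ₜu| ∈ L₂(Q(R,T))`, and (A.2.2)
`|∂ₜu + Δu| ≤ c₁ (|u| + |∇u|)` of Thm. 2.4. Then the quantity
`A₀ = max_{Q(3R/4, 3T/4)} (|u| + √T |∇u|)` of Lemma A.1 satisfies
`A₀ ≤ c₃(c₁, R, T) (∫_{Q(R,T)} |u|² dz)^{1/2}`, i.e. for every `(t, x)` with `0 < t < 3T/4`,
`|x| < 3R/4`: `|u(x,t)| + √T |∇u(x,t)| ≤ c₃ (∫_{Q(R,T)} |u|²)^{1/2}` (the estimate at time `t`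
only uses the part of the cylinder above `t`, the backward equation being solved downwards in
time, whence the bound holds down to `t → 0⁺`). Rendering: `u` of class `C²` on the open
cylinder (so that `∂ₜ`, `∇`, `Δ` are classical; the setting of the consumer
`ess_unique_continuation`) **together with** the (A.2.1) square-integrability over `Q(R,T)` of
`u`, `∇u` (`gradSq`), `∇²u` (the frame Hessian `Σᵢⱼ |∂ᵢ∂ⱼu|²`) and `∂ₜu`; the third hypothesis
(A.2.3) of the Remark's context (vanishing of infinite order at the origin) is deliberately
dropped: the bound is a regularity estimate that does not use it. Constants may also depend
on `n, m`. Time first, uncurried. [cite: Seregin2014, App. A.2 Remark A.2]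
[cite: LadyzhenskayaSolonnikovUraltseva1968, Chap. III §8 and Chap. IV §10 (local estimates; the source Seregin cites)] -/
def seregin_backwardHeat_localMax_le_L2 : Prop :=
  ∀ (n m : ℕ) (c₁ R T : ℝ), 0 < R → 0 < T → ∃ c₃ : ℝ, 0 < c₃ ∧
    ∀ (u : ℝ × EuclideanSpace ℝ (Fin n) → EuclideanSpace ℝ (Fin m)),
      ContDiffOn ℝ 2 u (Ioo (0 : ℝ) T ×ˢ Metric.ball (0 : EuclideanSpace ℝ (Fin n)) R) →
      IntegrableOn (fun z => ‖u z‖ ^ 2) (Ioo (0 : ℝ) T ×ˢ Metric.ball (0 : EuclideanSpace ℝ (Fin n)) R) →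
      IntegrableOn (fun z => gradSq u z) (Ioo (0 : ℝ) T ×ˢ Metric.ball (0 : EuclideanSpace ℝ (Fin n)) R) →
      IntegrableOn (fun z => ∑ i, ∑ j,
          ‖dx (stdOrthonormalBasis ℝ (EuclideanSpace ℝ (Fin n)) i)
            (dx (stdOrthonormalBasis ℝ (EuclideanSpace ℝ (Fin n)) j) u) z‖ ^ 2)
        (Ioo (0 : ℝ) T ×ˢ Metric.ball (0 : EuclideanSpace ℝ (Fin n)) R) →
      IntegrableOn (fun z => ‖dt u z‖ ^ 2) (Ioo (0 : ℝ) T ×ˢ Metric.ball (0 : EuclideanSpace ℝ (Fin n)) R) →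
      (∀ z ∈ Ioo (0 : ℝ) T ×ˢ Metric.ball (0 : EuclideanSpace ℝ (Fin n)) R,
        ‖dt u z + lap u z‖ ≤ c₁ * (‖u z‖ + Real.sqrt (gradSq u z))) →
      ∀ z ∈ Ioo (0 : ℝ) (3 * T / 4) ×ˢ Metric.ball (0 : EuclideanSpace ℝ (Fin n)) (3 * R / 4),
        ‖u z‖ + Real.sqrt T * Real.sqrt (gradSq u z) ≤
          c₃ * Real.sqrt (∫ w in Ioo (0 : ℝ) T ×ˢ Metric.ball (0 : EuclideanSpace ℝ (Fin n)) R, ‖u w‖ ^ 2)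

/-- **Seregin 2014, (A.3.7)** (from the regularity theory for parabolic equations, LSU 1968): in
the space–time half-space cylinder `Q₊ = ]0, 1[ × ℝⁿ₊`, `ℝⁿ₊ = {x | 0 < ⟪x, eₙ⟫}` (`eₙ` a unit
vector), Seregin asserts — inside the proof of Lemma A.2, whose context is (A.3.1)
`|∂ₜu + Δu| ≤ c₁(|u| + |∇u|)`, (A.3.2) `u(·,0) = 0` (with `u` extended by zero to `t < 0`),
(A.3.4) `u, ∂ₜu, ∇u, ∇²u` square integrable over bounded subdomains of `Q₊`, and (A.3.5)
`|u(x,t)| ≤ e^{A|x|²}` with `A ∈ [0, A₀]`, `A₀ < 1/32` — that "we may assume"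
`|u(x,t)| + |∇u(x,t)| ≤ c₃ e^{2A|x|²}` for all `(t, x) ∈ ]0, 1/2[ × (ℝⁿ₊ + eₙ)` (`⟪x, eₙ⟫ > 1`).
Rendering (an interior regularity estimate: the unit cylinders `]t, t + 1/2[ × B(x, 1)` above
such points stay inside `Q₊`, and `e^{A(|x|+1)²} ≤ e^{2A} e^{2A|x|²}`): `u` of class `C²` on the
open `Q₊` (classical derivatives; the setting of the consumer `ess_backward_uniqueness`)
**together with** (A.3.4) in the consumer's form (square-integrability of `u`, `∂ₜu`, `∇u`,
`∇²u` over bounded measurable subsets of `Q₊`), (A.3.1) and (A.3.5); of the printed context we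
deliberately drop (A.3.2) (not used by an interior estimate at times `t > 0`) and the
restriction `A ≤ A₀` (we allow every `A ≥ 0` and let `c₃ = c₃(c₁, A, n, m)` absorb `e^{2A}`).
Time first, uncurried. [cite: Seregin2014, App. A.3 (A.3.7)]
[cite: LadyzhenskayaSolonnikovUraltseva1968, Chap. III §8 and Chap. IV §10 (local estimates; the source Seregin cites)] -/
def seregin_backwardHeat_halfspace_gradient_growth : Prop :=
  ∀ (n m : ℕ) (c₁ A : ℝ), 0 ≤ A → ∃ c₃ : ℝ, 0 < c₃ ∧
    ∀ (e : EuclideanSpace ℝ (Fin n)), ‖e‖ = 1 →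
    ∀ (u : ℝ × EuclideanSpace ℝ (Fin n) → EuclideanSpace ℝ (Fin m)),
      ContDiffOn ℝ 2 u (Ioo (0 : ℝ) 1 ×ˢ {x | 0 < ⟪x, e⟫}) →
      (∀ K ⊆ Ioo (0 : ℝ) 1 ×ˢ {x : EuclideanSpace ℝ (Fin n) | 0 < ⟪x, e⟫},
        Bornology.IsBounded K → MeasurableSet K →
        IntegrableOn (fun z => ‖u z‖ ^ 2 + ‖dt u z‖ ^ 2 + gradSq u z +
          ∑ i, ∑ j, ‖dx (stdOrthonormalBasis ℝ (EuclideanSpace ℝ (Fin n)) i)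
            (dx (stdOrthonormalBasis ℝ (EuclideanSpace ℝ (Fin n)) j) u) z‖ ^ 2) K) →
      (∀ z ∈ Ioo (0 : ℝ) 1 ×ˢ {x : EuclideanSpace ℝ (Fin n) | 0 < ⟪x, e⟫},
        ‖dt u z + lap u z‖ ≤ c₁ * (‖u z‖ + Real.sqrt (gradSq u z))) →
      (∀ z ∈ Ioo (0 : ℝ) 1 ×ˢ {x : EuclideanSpace ℝ (Fin n) | 0 < ⟪x, e⟫},
        ‖u z‖ ≤ Real.exp (A * ‖z.2‖ ^ 2)) →
      ∀ z ∈ Ioo (0 : ℝ) (1 / 2) ×ˢ {x : EuclideanSpace ℝ (Fin n) | 1 < ⟪x, e⟫},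
        ‖u z‖ + Real.sqrt (gradSq u z) ≤ c₃ * Real.exp (2 * A * ‖z.2‖ ^ 2)

end Carleman

end Literature.Analysis.FluidPDE
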